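import Summits.HodgeConjecture.HodgeConjecture.Theorems.MarkmanPartnerTransportPartnerTransportIsometry
import Summits.HodgeConjecture.HodgeConjecture.Theorems.BoundaryReadoutPullbackAlgebraic
import Summits.HodgeConjecture.HodgeConjecture.Theses.MarkmanPartnerTransport
import Literature.AlgebraicGeometry.HodgeTheory.SmoothBlowupHodgeConjecture
import Literature.AlgebraicGeometry.HilbertScheme.HilbertSquareBlowupDiagonal
import Literature.AlgebraicGeometry.Hyperkaehler.K3HilbertSquareIncidence
import Literature.AlgebraicGeometry.HodgeTheory.ComplexOrientationFamily
import Literature.AlgebraicGeometry.HodgeTheory.ComplexConjugationHolds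

/-!
# Route MarkmanPartnerTransport · support #2 `PartnerTransport` (stmt-HodgeConjecture-19650) —
# PROVED modulo the named facts {Beauville incidence, Beauville/Fogarty double cover, Markman lift, Voisin cup}

**`PartnerTransport`** (R1 of ROUTE-P1D §3.2): for a marked smooth projective `K3^{[2]}`-type fourfold
`(X, φ, P, z)`, a marked projective K3 surface `(S, η, p, x)` and a transcendental Hodge isometry
`g : H²(S) → H²(X)` ((g1)–(g7)), `HC⁴(S × S) ⇒ HC⁴(X)`.  Proof = recipe A of the route's fact-reduction
memo with its step 4 replaced by GEOMETRIC DESCENT: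

1. `Beauville1983_hilbertSquare_markedIncidence`: the Hilbert square `H = S^{[2]}` with its marking
   `(φ_H, P_H, (x, 0))` and the algebraic incidence `θ`, `φ_H([θ]_* a) = (η a, 0)`.
2. **`HC⁴(S × S) ⇒ HC⁴(S^{[2]})`** (`hodgeConjectureFor_hilbertSquare_of_square`): `S^{[2]}` is the
   surjective image of the smooth blow-up `B_Δ(S × S)` of `S × S` along the diagonal
   (`HilbertScheme.Beauville1983_hilbertSquare_blowupDiagonal_surjection`, Beauville 1983 §6 (f) /
   Fogarty), so the tree's `hodgeConjectureFor_of_tower_surjective_le_five` (HC climbs smooth blow-ups with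
   centres of dimension `≤ 3` — the pull-back fact being the Summits THEOREM
   `fulton1998_map_mem_algebraicClasses_holds` — and descends along surjections,
   `SurjectiveDescent.hodgeConjectureFor_of_surjective`) applies.
3. Witt extension (`exists_markedHodgeIsometry_of_partner`, `…PartnerTransportIsometry`): `g|_{T(S)}`
   extends to a marked rational Hodge isometry `f : H²(S^{[2]}) ⥲ H²(X)`.
4. Markman transport: `Markman2024_rationalHodgeIsometry_lift_algebraic_marked.hodgeConjectureFor_iff_K3HilbertSquare`
   (PROVED consumer of the lift fact, p485393) gives `HC⁴(S^{[2]}) ↔ HC⁴(X)`.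

* `hodgeConjectureFor_hilbertSquare_of_square` — step 2 for every smooth projective surface;
* `partnerTransport_explicit` — the statement with the route's `let`s expanded;
* `partnerTransport_of_facts` — **{`Beauville1983_hilbertSquare_markedIncidence`,
  `Beauville1983_hilbertSquare_blowupDiagonal_surjection`,
  `Markman2024_rationalHodgeIsometry_lift_algebraic_marked`, `Voisin2003_cupProduct_algebraicClasses`} ⇒
  `PartnerTransport`** (CONDITIONAL on these four published theorems; everything else in-kernel).

Only the clauses (g1), (g2), (g5) of the partner datum are used (a `q`-isometry carrying the period
line to the period line is automatically a Hodge isometry); (g3), (g4), (g6), (g7) are idle here.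
No definition, no sorry. Prover seat hodge-nonav-19652-p1 (gen 6), `--supports stmt-HodgeConjecture-19650`.

References: A. Beauville, J. Differential Geom. 18 (1983) §6 (e)–(f), Prop. 6, §8–9; J. Fogarty,
Amer. J. Math. 90 (1968) Thm. 2.4; E. Markman, Compos. Math. 160 (2024) Thm. 1.1, 1.4; D. Arapura,
Adv. Math. 207 (2006) Cor. 1.2 / (2001) Lemma 16; J. P. Murre, Indag. Math. 39 (1977) Lemma 2;
J.-P. Serre, *A Course in Arithmetic* IV §1.5; C. Voisin, *Hodge Theory II* Prop. 9.20–9.21.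
-/

noncomputable section

set_option linter.dupNamespace false

open scoped Matrix
open Module CategoryTheory MonoidalCategory AlgebraicGeometry
open Literature.AlgebraicTopology.SingularHomology Literature.Geometry.Kaehler
open Literature.AlgebraicGeometry Literature.AlgebraicGeometry.Motives Literature.AlgebraicGeometry.HodgeTheory
open Literature.AlgebraicGeometry.Hyperkaehler Literature.AlgebraicGeometry.Surfaces
open Literature.AlgebraicGeometry.HilbertScheme
open Summit.HodgeConjecture.HodgeConjecture.Theorems.NikulinTwinTransport
open Summit.HodgeConjecture.HodgeConjecture.Theorems.MarkmanPartnerTransport.BBFPositivity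

namespace Summit.HodgeConjecture.HodgeConjecture.Theorems.MarkmanPartnerTransport.PartnerLattice

/-- `MarkedK3Sq[X, φ, P, z]`: VERBATIM the `let MarkedK3Sq := …` binder of the route declarations of
MarkmanPartnerTransport (clauses (m1)–(m6)). Local notation only. -/
local notation3 (prettyPrint := false) "MarkedK3Sq[" X ", " φ ", " P ", " z "]" =>
  (((IsIntegralClass P ∧ ∀ Q : complexBetti X (2 * 4), IsIntegralClass Q → ∃ n : ℤ, Q = n • P) ∧
    (∀ c : complexBetti X 2, IsIntegralClass c ↔ ∃ v : K3HilbertIndex → ℤ, φ c = fun i => (v i : ℂ)) ∧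
    (∀ a : complexBetti X 2, cupPowTwo a 4 = ((3 : ℂ) * (k3HilbertForm 2 (φ a) (φ a)) ^ 2) • P) ∧
    (IsOfHodgeType 4 X 2 2 0 (LinearEquiv.symm φ z) ∧
      ∀ τ : complexBetti X 2, IsOfHodgeType 4 X 2 2 0 τ → ∃ t : ℂ, τ = t • LinearEquiv.symm φ z) ∧
    (∀ c : complexBetti X 2, IsOfHodgeType 4 X 2 1 1 c ↔
      (k3HilbertForm 2 (φ c) z = 0 ∧ k3HilbertForm 2 (φ c) (star z) = 0)) ∧
    (k3HilbertForm 2 z z = 0 ∧ 0 < (k3HilbertForm 2 (star z) z).re)))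

/-! ### Step 2: `HC⁴(S × S) ⇒ HC⁴(S^{[2]})` by blow-up and surjective descent -/

/-- **The Hodge conjecture passes from `S × S` to the Hilbert square `S^{[2]}`** of a smooth projective
surface `S`: `S^{[2]}` is the surjective image of the smooth blow-up of `S × S` along the diagonal
(`Beauville1983_hilbertSquare_blowupDiagonal_surjection`), a one-step smooth blow-up tower on a
fourfold (centre of dimension `2`), so `hodgeConjectureFor_of_tower_surjective_le_five` applies with the
pull-back fact discharged by `fulton1998_map_mem_algebraicClasses_holds`. (de Cataldo–Migliorini's
`HC(S^{[2]}) ⇐ HC(S × S)` for `n = 2`, here by Murre/Arapura blow-up invariance + descent.)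
[cite: Beauville1983, §6 (e)–(f), p. 766] [cite: Arapura2001HodgeCyclesModuli, Lemma 13 and Lemma 16]
[cite: Murre1977, Lemma 2 (p. 231)] -/
theorem hodgeConjectureFor_hilbertSquare_of_square (hρ : Beauville1983_hilbertSquare_blowupDiagonal_surjection)
    {S H : SchemeOver ℂ} (hS : IsSmoothProjective 2 S) {Ξ : (S ⊗ H).left.IdealSheafData}
    (hHilb : IsHilbertSchemeOfPoints 2 S H Ξ) (hH : IsSmoothProjective 4 H)
    (h : HodgeConjectureFor 4 (S ⊗ S)) : HodgeConjectureFor 4 H := by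
  obtain ⟨B, b, ρ, hBl, hρs⟩ := hρ S hS H Ξ hHilb
  haveI := hρs
  exact hodgeConjectureFor_of_tower_surjective_le_five fulton1998_map_mem_algebraicClasses_holds (n := 4)
    (by norm_num) (Relation.ReflTransGen.single (hBl.smoothBlowupStep (by norm_num))) hBl.top hH ρ h

/-! ### `PartnerTransport` -/

/-- **`PartnerTransport` with the route's `let`s expanded, modulo the four named facts** (module
docstring: Beauville's marked Hilbert square; `HC⁴(S × S) ⇒ HC⁴(S^{[2]})` by blow-up and surjective
descent; Witt extension of `g|_{T(S)}` to a marked rational Hodge isometry `H²(S^{[2]}) ⥲ H²(X)`; Markman's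
algebraic lift transports the Hodge conjecture). [cite: Markman2024, §1.1 Thm. 1.1 and Thm. 1.4]
[cite: Beauville1983, §6 (e)–(f), Prop. 6 and §9 Lemme 1] [cite: Serre1973, Ch. IV §1.5 Thm 3, p. 30] -/
theorem partnerTransport_explicit (hB : Beauville1983_hilbertSquare_markedIncidence)
    (hρ : Beauville1983_hilbertSquare_blowupDiagonal_surjection)
    (hMk : Markman2024_rationalHodgeIsometry_lift_algebraic_marked)
    (hcup : Voisin2003_cupProduct_algebraicClasses)
    {X : SchemeOver ℂ} (hX : IsSmoothProjective 4 X) (hK : IsOfK3HilbertSquareType X)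
    {φ : complexBetti X 2 ≃ₗ[ℂ] (K3HilbertIndex → ℂ)} {P : complexBetti X (2 * 4)} {z : K3HilbertIndex → ℂ}
    (hM : MarkedK3Sq[X, φ, P, z])
    {S : SchemeOver ℂ} (hS : IsK3Surface S) {η : complexBetti S (2 * 1) ≃ₗ[ℂ] (K3Index → ℂ)}
    {p : complexBetti S (2 * 2)} {x : K3Index → ℂ}
    (hmk : IsIntegralClass p ∧ (∀ q : complexBetti S (2 * 2), IsIntegralClass q → ∃ n : ℤ, q = n • p) ∧
        (∀ c : complexBetti S (2 * 1), IsIntegralClass c ↔ ∃ v : K3Index → ℤ, η c = fun i => (v i : ℂ)) ∧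
        (∀ a b : complexBetti S (2 * 1), cupProduct (rfl : 2 * 1 + 2 * 1 = 2 * 2) a b = k3Form (η a) (η b) • p) ∧
        IsOfHodgeType 2 S (2 * 1) 2 0 (LinearEquiv.symm η x) ∧
        (∀ τ : complexBetti S (2 * 1), IsOfHodgeType 2 S (2 * 1) 2 0 τ → ∃ t : ℂ, τ = t • LinearEquiv.symm η x))
    (hxx : k3Form x x = 0) (hxpos : 0 < (k3Form (star x) x).re)
    (hu : ∃ u : K3Index → ℤ, k3Form (fun i => (u i : ℂ)) x = 0 ∧ 0 < ∑ i, ∑ j, u i * k3Gram i j * u j)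
    {g : complexBetti S (2 * 1) →ₗ[ℂ] complexBetti X 2}
    (hg1 : ∀ a, IsRationalClass a → IsRationalClass (g a))
    (hg2 : ∀ (i j : ℕ) a, IsOfHodgeType 2 S (2 * 1) i j a → IsOfHodgeType 4 X 2 i j (g a))
    (hg5 : ∀ a b, (∀ d ∈ algebraicClasses S 1, cupProduct (rfl : 2 * 1 + 2 * 1 = 2 * 2) a d = 0) →
      (∀ d ∈ algebraicClasses S 1, cupProduct (rfl : 2 * 1 + 2 * 1 = 2 * 2) b d = 0) →
      k3HilbertForm 2 (φ (g a)) (φ (g b)) = k3Form (η a) (η b))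
    (hHC : HodgeConjectureFor 4 (S ⊗ S)) : HodgeConjectureFor 4 X := by
  obtain ⟨h1X, h2X, h3X, -⟩ := id hM
  have hηint := hmk.2.2.1
  have hcupS := hmk.2.2.2.1
  have h20 := hmk.2.2.2.2.1
  have hS2 : IsSmoothProjective 2 S := IsK3Surface.isSmoothProjective hS
  have hμ := hasPoincareDuality_complexOrientationFamily
  -- step 1: Beauville's marked Hilbert square
  obtain ⟨H, hH, Ξ, φH, PH, hHilb, hHK, hMH, θ, hθ, hi⟩ :=
    hB complexOrientationFamily hμ S hS η p x hmk hxx hxpos hu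
  -- step 2: HC⁴(S × S) ⇒ HC⁴(S^{[2]})
  have hHCH : HodgeConjectureFor 4 H := hodgeConjectureFor_hilbertSquare_of_square hρ hS2 hHilb hH hHC
  -- step 3: Witt extension to a marked rational Hodge isometry `H²(H) ⥲ H²(X)`
  obtain ⟨f, hfbij, hfrat, hfh, hfq⟩ := exists_markedHodgeIsometry_of_partner hcup hμ hX hM hS hηint hcupS
    h20 hxpos hH hMH hθ hi hg1 hg2 hg5
  -- step 4: Markman transport
  obtain ⟨h1H, h2H, h3H, -⟩ := hMH
  obtain ⟨AH⟩ := (nonempty_hodgeModel_holds (n := 4) (X := H)).nonempty hH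
  obtain ⟨AX⟩ := (nonempty_hodgeModel_holds (n := 4) (X := X)).nonempty hX
  exact (hMk.hodgeConjectureFor_iff_K3HilbertSquare hcup hμ hH hX hHK hK h1H h2H h3H h1X h2X h3X
    hfbij hfrat hfh hfq AH AX).1 hHCH

/-- **`PartnerTransport` (R1 of ROUTE-P1D §3.2; route MarkmanPartnerTransport, support #2) holds modulo
the named facts `Beauville1983_hilbertSquare_markedIncidence`,
`HilbertScheme.Beauville1983_hilbertSquare_blowupDiagonal_surjection`,
`Markman2024_rationalHodgeIsometry_lift_algebraic_marked` and `Voisin2003_cupProduct_algebraicClasses`** —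
the route declaration itself, CONDITIONAL on these four published theorems (Witt, Lefschetz `(1,1)`, the
blow-up invariance with its pull-back input, and the surjective descent are tree theorems).
[cite: Markman2024, §1.1 Thm. 1.1 and Thm. 1.4] [cite: Beauville1983, §6 (e)–(f) and Prop. 6]
[cite: Arapura2001HodgeCyclesModuli, Lemma 16 and Cor. 17] -/
theorem partnerTransport_of_facts (hB : Beauville1983_hilbertSquare_markedIncidence)
    (hρ : Beauville1983_hilbertSquare_blowupDiagonal_surjection)
    (hMk : Markman2024_rationalHodgeIsometry_lift_algebraic_marked)
    (hcup : Voisin2003_cupProduct_algebraicClasses) :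
    Summit.HodgeConjecture.HodgeConjecture.Theses.MarkmanPartnerTransport.PartnerTransport := by
  intro X hX hK φ P z hM S hS η p x hMS g hg hHC
  obtain ⟨-, hmk, hxx, hxpos, hu⟩ := hMS
  obtain ⟨hg1, hg2, -, -, hg5, -, -⟩ := hg
  exact partnerTransport_explicit hB hρ hMk hcup hX hK hM hS hmk hxx hxpos hu hg1 hg2 hg5 hHC

end Summit.HodgeConjecture.HodgeConjecture.Theorems.MarkmanPartnerTransport.PartnerLattice

end
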